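import Literature.NumberTheory.EllipticCurves.CMNewformGamma0LevelDvdProofs
import Literature.NumberTheory.EllipticCurves.CMNewformGamma0PrimitiveIsNewform
import Literature.NumberTheory.EllipticCurves.NewformsEqOfHeckeEigenvalueEqProofs
import Literature.NumberTheory.GaloisRepresentations.GrossencharakterConductor
import Summits.BirchSwinnertonDyer.BirchSwinnertonDyer.Theorems.SignedLowerHalvesSmallImageLowerHalfBothSignsLambdaLowerThreeNsThetaPartnerSharpExport
import HarnessLib

/-!
# Route `SignedLowerHalves`, crux L `SmallImageLowerHalfBothSigns` (stmt-BirchSwinnertonDyer-23599), line `rtt_w3`: DE-CITE of the Ribet (BAD)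
# conjunct, FILE 1 of 3 — ALL Fourier coefficients of the `Γ₀` CM newform pinned to `ψ`, through Shimura's newness of the theta series of the
# PRIMITIVE Größencharakter (INPUTS seat `bsd-inputs-honda-p1` g33; THEOREMS ONLY, conditional on ONE cited Literature named fact taken as a hypothesis)

WHAT.  The cite stub `stub_citedInputs_rtt` of line `rtt_w3` (v45/v46) carries the bespoke residual named fact
`Ribet1977_cmNewform_gamma0_badEulerFactor_padicCharacter` (the Euler factors of the CM newform `g` at the primes `ℓ ∣ |d_K|·N𝔪`, through the
`p`-adic avatar `θ`).  Width seat -w3 g31 sized its de-cite (bus 2026-08-31T19:06Z): it needs (M1) «`θ_{ψ₀}` is NEW of level exactly `|d_K|·N𝔣`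
for the PRIMITIVE `ψ₀`» — Shimura 1971/72 (Ribet 1977 §3 Remark (3.5)), Miyake Thm. 4.8.2 — as ONE standard named fact, plus tree theorems.  That ONE fact is
now the Literature named fact `shimura1972_heckeTheta_isNewform0_of_primitive` (`Literature/NumberTheory/EllipticCurves/CMNewformGamma0PrimitiveIsNewform.lean`,
honda g33 p832644).  This file PROVES from it ★ `exists_primitive_embCoeff_eq`: for the data of the residual fact (`K` imaginary
quadratic, `(𝔪, ψ)` a type-`(1,0)` Größencharakter datum with trivial Nebentypus, a newform `g ∈ S₂(Γ₀(M))` with `p`-adically embedded GOOD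
coefficients `ι(a_ℓ(g)) = e⁻¹(Σ_{Nw=ℓ} ψ w)`), there is the PRIMITIVE companion `(𝔠, ψ₀)` of `(𝔪, ψ)` (tree theorem
`IsGrossencharakter.exists_primitive`, honda g33 p832516: the conductor and the primitive values) such that `M = |d_K|·N𝔠` and
**`ι(a_n(g)) = e⁻¹(Σ_{N𝔞 = n, (𝔞,𝔠)=1} ψ̃₀(𝔞))` for EVERY `n ≥ 1`** — the bad coefficients included.  PROOF: `θ₀ :=` Hecke's theta cusp form of
`(𝔠, ψ₀)` on `Γ₀(|d_K|·N𝔠)` (tree theorem `HeckeTheta.heckeThetaCuspForm_of_isGrossencharakter`, with the Nebentypus clause transferred to the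
primitive pair by `nebentypus_of_sharp`) is a newform by the cited fact; the Galois conjugate `g^{e∘ι}` (`GaloisConjugate.exists_isNewform0_conj`) has
the same Hecke eigenvalues as `θ₀` at every `ℓ ∤ |d_K|·N𝔪`; strong multiplicity one across levels (`IsNewform0.level_eq_of_heckeEigenvalue_eq_holds`)
gives `M = |d_K|·N𝔠`, then at one level (`IsNewform0.eq_of_heckeEigenvalue_eq_holds`) `g^{e∘ι} = θ₀`, i.e. all coefficients agree.
Files 2–3 (`…RibetBadEulerFactorAvatar`, `…RibetBadEulerFactorOfNewness`) transfer the `p`-adic avatar to `(𝔠, ψ₀)` and assemble the (BAD) identity.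

HONEST SCOPE: count-NEUTRAL hygiene (one bespoke residual cite ↔ one textbook cite, director-bsd (918)(b)/(922)(i)); nothing here closes a stub;
crux L is a kernel theorem only modulo its cited print facts and crux M; BSD is proved for NO curve.

References: [Ribet1977Nebentypus] §3 Thm. (3.4), Cor. (3.5), Remark (3.5) (LNM 601 pp. 34–35); [Shimura1972ClassFieldsRealQuadratic] p. 138;
[Shimura1971CMFactorsJacobians] Lemma 3; [Miyake2006] Thm. 4.6.17, Thm. 4.8.2; [NeukirchANT1999] VII §6 (6.11)–(6.14); [AtkinLehner1970] Thm. 4;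
[DiamondShurman2005] Thm. 6.5.4.
-/

set_option autoImplicit false

noncomputable section

open scoped NumberField ModularForm MatrixGroups
open NumberField IsDedekindDomain CongruenceSubgroup Filter UpperHalfPlane
open Literature.NumberTheory.GaloisRepresentations Literature.NumberTheory.LFunctions Literature.NumberTheory.EllipticCurves
  Literature.NumberTheory.EllipticCurves.ModularForms Literature.NumberTheory.Automorphic

namespace Summit.BirchSwinnertonDyer.BirchSwinnertonDyer.Theorems.RibetBadEulerFactor

/-! ## §1 (The ONE cited input, `shimura1972_heckeTheta_isNewform0_of_primitive`, is the Literature file `CMNewformGamma0PrimitiveIsNewform.lean`.) -/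

/-! ## §2 Bookkeeping: the theta series' Fourier coefficients; norms and the modulus -/

section Bookkeeping

variable {K : Type} [Field K] [NumberField K]

/-- The `q`-expansion coefficients of Hecke's theta cusp form on `Γ₀(N)` read through the tree's `cuspCoeff` (via the `Γ₁`-lift, whose underlying
function is the same; `qExpansion_coeff_eq_of_hasSum`). [cite: Ribet1977Nebentypus, §3 Thm. (3.4)] -/
theorem cuspCoeff_eq_of_hasSum_theta {N : ℕ} [NeZero N] {k : ℤ} (g : CuspForm (Gamma0 N) k) (c : ℕ → ℂ)
    (hg : ∀ τ : UpperHalfPlane, HasSum (fun n : ℕ => c n * Complex.exp (2 * Real.pi * Complex.I * (τ : ℂ)) ^ n) (g τ)) (n : ℕ) :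
    cuspCoeff g n = c n := by
  set g₁ : CuspForm (Gamma1 N) k := liftToGamma1 N k g with hg₁
  have hcoe₁ : (⇑g₁ : UpperHalfPlane → ℂ) = ⇑g := coe_liftToGamma1_holds N k g
  have hq : (qExpansion 1 ⇑g₁).coeff n = c n := by
    refine Literature.NumberTheory.ModularForms.qExpansion_coeff_eq_of_hasSum (c := c)
      (SlashInvariantFormClass.periodic_comp_ofComplex g₁ (HeckeTGamma1.one_mem_strictPeriods_Gamma1 N))
      (ModularFormClass.holo g₁) (ModularFormClass.bdd_at_infty g₁) (fun τ => ?_) n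
    rw [hcoe₁]
    refine (hg τ).congr_fun fun m => ?_
    rw [smul_eq_mul, Function.Periodic.qParam]
    congr 2
    push_cast
    ring_nf
  rw [cuspCoeff, ← hcoe₁]
  exact hq

/-- A place of norm dividing neither `N𝔪` is prime to `𝔪`: `𝔪 ⊆ 𝔭_w` forces `N𝔭_w ∣ N𝔪`. [cite: NeukirchANT1999, Ch. I (8.2)] -/
theorem not_le_asIdeal_of_not_dvd_absNorm' {𝔪 : Ideal (𝓞 K)} {w : HeightOneSpectrum (𝓞 K)} {ℓ : ℕ}
    (hw : Ideal.absNorm w.asIdeal = ℓ) (hℓ : ¬ ℓ ∣ Ideal.absNorm 𝔪) : ¬ 𝔪 ≤ w.asIdeal := fun hle =>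
  hℓ (hw ▸ Ideal.absNorm_dvd_absNorm_of_le hle)

end Bookkeeping

/-! ## §3 ★ All coefficients of the pinned newform, through the primitive companion -/

section Main

variable {K : Type} [Field K] [NumberField K]

/-- ★ **The `Γ₀` CM newform pinned to `ψ` at the good primes IS the theta series of the primitive companion `(𝔠, ψ₀)`: level `M = |d_K|·N𝔠` and
ALL Fourier coefficients `ι(a_n(g)) = e⁻¹(Σ_{N𝔞 = n, (𝔞,𝔠)=1} ψ̃₀(𝔞))`** (granted Shimura's newness fact).  Output, for the downstream files: the
primitive companion with `𝔠 ≠ 0`; `𝔠 ∣ 𝔪` (`𝔪 ⊆ 𝔠`); `IsGrossencharakter 𝔠 (embType σ) (embTypeConj σ) ψ₀`; `ψ₀ = ψ` off `𝔪`; `ψ₀` never zero;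
sharpness (the primes of `𝔠` are exactly the ramified places of every Hecke character realising `ψ₀`); the Nebentypus clause for `(𝔠, ψ₀)`;
`M = |d_K|·N𝔠`; and the coefficient identity for every `n ≥ 1`.
[cite: Ribet1977Nebentypus, §3 Cor. (3.5) and Remark (3.5)] [cite: AtkinLehner1970, Thm. 4] [cite: DiamondShurman2005, Thm. 6.5.4] -/
theorem exists_primitive_embCoeff_eq (hSh : shimura1972_heckeTheta_isNewform0_of_primitive)
    (hK2 : Module.finrank ℚ K = 2) (htc : IsTotallyComplex K) (σK : K →+* ℂ) {𝔪 : Ideal (𝓞 K)} (h𝔪 : 𝔪 ≠ ⊥)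
    {ψ : HeightOneSpectrum (𝓞 K) → ℂ} (hψ : IsGrossencharakter 𝔪 (embType σK) (embTypeConj σK) ψ)
    (hψpow : ∀ n : ℕ, Odd n → n.Coprime ((discr K).natAbs * Ideal.absNorm 𝔪) →
      idealPow K ψ (Ideal.span {(n : 𝓞 K)}) = (jacobiSym (discr K) n : ℂ) * (n : ℂ) ^ (2 - 1))
    {p : ℕ} [Fact p.Prime] (e : PadicAlgCl p ≃+* ℂ) {M : ℕ} [NeZero M] {g : CuspForm (Gamma0 M) 2} (ι : coeffField g →+* PadicAlgCl p)
    (hng : IsNewform0 g)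
    (hcoeffψ : ∀ ℓ : ℕ, ℓ.Prime → ¬ ℓ ∣ (discr K).natAbs * Ideal.absNorm 𝔪 →
      embCoeff g ι ℓ = e.symm (∑ᶠ (w : HeightOneSpectrum (𝓞 K)) (_ : Ideal.absNorm w.asIdeal = ℓ), ψ w)) :
    ∃ (𝔠 : Ideal (𝓞 K)) (ψ₀ : HeightOneSpectrum (𝓞 K) → ℂ),
      𝔠 ≠ ⊥ ∧ 𝔪 ≤ 𝔠 ∧ IsGrossencharakter 𝔠 (embType σK) (embTypeConj σK) ψ₀ ∧
      (∀ v : HeightOneSpectrum (𝓞 K), ¬ 𝔪 ≤ v.asIdeal → ψ₀ v = ψ v) ∧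
      (∀ v : HeightOneSpectrum (𝓞 K), ψ₀ v ≠ 0) ∧
      (∀ χ : HeckeCharacter K, (∀ᶠ v in cofinite, χ.valueAtUniformizer v = ψ₀ v) →
        ∀ w : HeightOneSpectrum (𝓞 K), 𝔠 ≤ w.asIdeal ↔ ¬ χ.IsUnramifiedAt w) ∧
      (∀ n : ℕ, Odd n → n.Coprime ((discr K).natAbs * Ideal.absNorm 𝔠) →
        idealPow K ψ₀ (Ideal.span {(n : 𝓞 K)}) = (jacobiSym (discr K) n : ℂ) * (n : ℂ) ^ (2 - 1)) ∧
      M = (discr K).natAbs * Ideal.absNorm 𝔠 ∧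
      ∀ n : ℕ, 0 < n → embCoeff g ι n = e.symm (∑ᶠ J ∈ {J : Ideal (𝓞 K) | Ideal.absNorm J = n}, rayClassCoeff 𝔠 ψ₀ J) := by
  classical
  haveI := htc
  -- the primitive companion
  obtain ⟨𝔠, ψ₀, h𝔠, hle, hψ₀, heq, hne0, hsharp, hprim⟩ := hψ.exists_primitive h𝔪
  -- the Nebentypus clause transfers to the primitive pair
  have hneb₀ : ∀ n : ℕ, Odd n → n.Coprime ((discr K).natAbs * Ideal.absNorm 𝔠) →
      idealPow K ψ₀ (Ideal.span {(n : 𝓞 K)}) = (jacobiSym (discr K) n : ℂ) * (n : ℂ) ^ (2 - 1) :=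
    SmallImageLambdaLowerThreeNsThetaPartner.nebentypus_of_sharp hK2 σK h𝔪 h𝔠 hψ₀ heq hψpow
  -- weight-2 spelling of the type
  have h1 : (fun w => (((2 : ℕ) : ℤ) - 1) * embType σK w) = embType σK := funext fun w ↦ by push_cast; ring
  have h2 : (fun w => (((2 : ℕ) : ℤ) - 1) * embTypeConj σK w) = embTypeConj σK := funext fun w ↦ by push_cast; ring
  have hψ₀' : IsGrossencharakter 𝔠 (fun w => (((2 : ℕ) : ℤ) - 1) * embType σK w) (fun w => (((2 : ℕ) : ℤ) - 1) * embTypeConj σK w) ψ₀ := by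
    rw [h1, h2]; exact hψ₀
  have hprim' : ∀ (𝔣₁ : Ideal (𝓞 K)) (ψ₁ : HeightOneSpectrum (𝓞 K) → ℂ), 𝔠 ≤ 𝔣₁ →
      (∀ v : HeightOneSpectrum (𝓞 K), ¬ 𝔠 ≤ v.asIdeal → ψ₁ v = ψ₀ v) →
      IsGrossencharakter 𝔣₁ (fun w => (((2 : ℕ) : ℤ) - 1) * embType σK w) (fun w => (((2 : ℕ) : ℤ) - 1) * embTypeConj σK w) ψ₁ →
      𝔣₁ = 𝔠 := by
    intro 𝔣₁ ψ₁ hle₁ hag hψ₁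
    rw [h1, h2] at hψ₁
    exact hprim 𝔣₁ ψ₁ hle₁ hag hψ₁
  -- Hecke's theta cusp form of the primitive pair, on `Γ₀(|d_K|·N𝔠)`
  set N₀ : ℕ := (discr K).natAbs * Ideal.absNorm 𝔠 with hN₀def
  have hc0 : Ideal.absNorm 𝔠 ≠ 0 := by rw [Ne, Ideal.absNorm_eq_zero_iff]; exact h𝔠
  haveI hN₀ : NeZero N₀ := ⟨mul_ne_zero (Int.natAbs_ne_zero.mpr (NumberField.discr_ne_zero K)) hc0⟩
  obtain ⟨θ₀, hθ₀⟩ := HeckeTheta.heckeThetaCuspForm_of_isGrossencharakter K hK2 htc σK 2 le_rfl even_two 𝔠 h𝔠 ψ₀ hψ₀' hneb₀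
  have hqθ : ∀ n : ℕ, 0 < n → cuspCoeff θ₀ n = ∑ᶠ J ∈ {J : Ideal (𝓞 K) | Ideal.absNorm J = n}, rayClassCoeff 𝔠 ψ₀ J :=
    fun n _ => cuspCoeff_eq_of_hasSum_theta θ₀ _ hθ₀ n
  -- Shimura: `θ₀` is a newform
  have hnewθ : IsNewform0 θ₀ := hSh K hK2 htc σK 2 le_rfl 𝔠 h𝔠 ψ₀ hψ₀' hprim' hneb₀ θ₀ hqθ
  -- the conjugate newform `g^{e∘ι}` and its good eigenvalues
  obtain ⟨g', hg', hcoeff⟩ := GaloisConjugate.exists_isNewform0_conj le_rfl g hng ((e : PadicAlgCl p →+* ℂ).comp ι)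
  have hgood : ∀ ℓ : ℕ, ℓ.Prime → ¬ ℓ ∣ (discr K).natAbs * Ideal.absNorm 𝔪 → cuspCoeff g' ℓ = cuspCoeff θ₀ ℓ := by
    intro ℓ hℓ hℓN
    rw [hcoeff ℓ, RingHom.comp_apply, ← embCoeff_def, hcoeffψ ℓ hℓ hℓN, RingEquiv.coe_toRingHom, e.apply_symm_apply,
      hqθ ℓ hℓ.pos]
    -- `Σ_{Nw = ℓ} ψ w = Σ_{NJ = ℓ} rayClassCoeff 𝔠 ψ₀ J` at `ℓ ∤ |d_K|·N𝔪`
    have hℓ𝔪 : ¬ ℓ ∣ Ideal.absNorm 𝔪 := fun h => hℓN (h.mul_left _)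
    change ∑ᶠ w ∈ {w : HeightOneSpectrum (𝓞 K) | Ideal.absNorm w.asIdeal = ℓ}, ψ w = _
    symm
    refine (finsum_mem_eq_of_bijOn (fun w : HeightOneSpectrum (𝓞 K) => w.asIdeal) ⟨fun w hw => hw, ?_, ?_⟩ fun w hw => ?_).symm
    · exact fun w₁ _ w₂ _ h => HeightOneSpectrum.ext h
    · intro J hJ
      have hJℓ : Ideal.absNorm J = ℓ := hJ
      have hprime : J.IsPrime := Ideal.isPrime_of_irreducible_absNorm (hJℓ ▸ hℓ)
      have hJ0 : J ≠ ⊥ := by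
        rintro rfl
        rw [Ideal.absNorm_bot] at hJℓ
        exact hℓ.ne_zero hJℓ.symm
      exact ⟨⟨J, hprime, hJ0⟩, hJℓ, rfl⟩
    · -- `rayClassCoeff 𝔠 ψ₀ 𝔭_w = ψ₀ w = ψ w` for `w ∤ 𝔪`
      have hw𝔪 : ¬ 𝔪 ≤ w.asIdeal := not_le_asIdeal_of_not_dvd_absNorm' hw hℓ𝔪
      have hw𝔠 : ¬ 𝔠 ≤ w.asIdeal := fun h => hw𝔪 (hle.trans h)
      have hcop : IsCoprime w.asIdeal 𝔠 := by
        rw [Ideal.isCoprime_iff_sup_eq]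
        by_contra hne
        rcases w.isMaximal.eq_of_le (J := w.asIdeal ⊔ 𝔠) (fun h => hne h) le_sup_left with h
        exact hw𝔠 (h ▸ le_sup_right)
      rw [rayClassCoeff_asIdeal_of_isCoprime _ _ hcop, heq w hw𝔪]
  have hD0 : (discr K).natAbs * Ideal.absNorm 𝔪 ≠ 0 := by
    refine mul_ne_zero (Int.natAbs_ne_zero.mpr (NumberField.discr_ne_zero K)) ?_
    rw [Ne, Ideal.absNorm_eq_zero_iff]; exact h𝔪
  have hfin : {q : ℕ | q.Prime ∧ heckeEigenvalue g' q ≠ heckeEigenvalue θ₀ q}.Finite := by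
    refine (Finset.finite_toSet ((discr K).natAbs * Ideal.absNorm 𝔪).primeFactors).subset fun q hq ↦ ?_
    obtain ⟨hq, hne⟩ := hq
    rw [Finset.mem_coe, Nat.mem_primeFactors]
    refine ⟨hq, ?_, hD0⟩
    by_contra hqd
    apply hne
    rw [heckeEigenvalue_eq_coeff_of_isNormalized hg'.2.2 hq (hg'.2.1 q hq), heckeEigenvalue_eq_coeff_of_isNormalized hnewθ.2.2 hq (hnewθ.2.1 q hq)]
    exact hgood q hq hqd
  -- strong multiplicity one: the level, then the form
  have hMN : M = N₀ := IsNewform0.level_eq_of_heckeEigenvalue_eq_holds (N := M) (k := 2) hg' hnewθ hfin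
  subst hMN
  have hgθ : g' = θ₀ := IsNewform0.eq_of_heckeEigenvalue_eq_holds hg' hnewθ hfin
  refine ⟨𝔠, ψ₀, h𝔠, hle, hψ₀, heq, hne0, hsharp, hneb₀, rfl, fun n hn => ?_⟩
  apply e.injective
  rw [e.apply_symm_apply, ← hqθ n hn, ← hgθ, hcoeff n, RingHom.comp_apply, ← embCoeff_def, RingEquiv.coe_toRingHom]

end Main

end Summit.BirchSwinnertonDyer.BirchSwinnertonDyer.Theorems.RibetBadEulerFactor

end
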